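import Summits.ResolutionOfSingularities.ResolutionOfSingularities.Theorems.PurelyInseparableDim4IsolationConverse
import Summits.ResolutionOfSingularities.ResolutionOfSingularities.Theorems.PurelyInseparableDim4IsolatedScope
import Literature.RingTheory.MvPowerSeries.MaximalIdealPow
import Literature.AlgebraicGeometry.Resolution.MvPowerSeriesChainRule
import Mathlib.RingTheory.Nakayama
import Mathlib.RingTheory.Finiteness.Ideal
import HarnessLib
import HarnessLib.Audit.Tags

/-!
# Purely inseparable four-folds — an ISOLATED double point has a FINITE formal Milnor algebra
# (bridge WildCones ↔ `PIDim4`, part 1; cell `res-dim4-pi`, p-12 bridge lead, desk WORD #30 (b))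

[OURS · counted 0 · bookkeeping between two typings of this tree; nothing here is a statement about
resolution of singularities.]

The in-house route `WildCones` (res-hironaka W4.1) proved the Milnor drop for formal pairs in
characteristic `2` (`WildCones.MuDropCharTwoOrdP.series_drop`) under the hypothesis that the formal
Milnor algebras `K⟦x⟧ ⧸ ⟨∂₁f, …, ∂ₙf⟩` are FINITE over `K`.  The cell's frame types isolation of the
`q`-fold locus algebraically (`PIDim4.IsIsolated q F`: the minimal primes of
`J_q⁺(F) = ⟨D^{(α)}F : 0 < |α| < q⟩ ⊂ K[x₁..x₄]` inside `𝔪₀`).  This file is the passage between the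
two at `q = 2` (where `J₂⁺(F) = ⟨∂ᵢF⟩`, p-3's `IsolationCert.singLocusIdeal_two`):

* §1 `map_originIdeal_coe` — under `K[x] → K⟦x⟧` the origin ideal `𝔪₀` generates the maximal ideal
  `𝔪̂` (both are `(x₁, …, x₄)`; tree: `IsolatedScope.originIdeal_eq_span_X`,
  `Literature…Jets.maximalIdeal_pow_eq_span_monomial`); `span_pderiv_coe` — the formal Jacobian
  ideal of `↑F` is generated by the image of `J₂⁺(F)` (`MvPowerSeries.pderiv_coe`).
* §2 **`milnorFinite_of_isIsolated_two`** — `IsIsolated 2 F ⇒ K⟦x⟧ ⧸ ⟨∂ᵢ ↑F⟩` is finite over `K`: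
  p-14's certificate `𝔪₀ᴺ ≤ J₂⁺(F) + 𝔪₀ᴺ⁺¹` (`IsolationConverse.exists_certificate_of_isIsolated`)
  is pushed to `K⟦x⟧`, where Nakayama (`𝔪̂` = Jacobson radical of the local ring `K⟦x⟧`) upgrades it
  to `𝔪̂ᴺ ≤ ⟨∂ᵢ ↑F⟩`, and `K⟦x⟧ ⧸ 𝔪̂ᴺ` is finite (`Jets.finite_quotient_maximalIdeal_pow`).

Nothing here proves `NoIsolatedTrap` or resolution of singularities in dimension ≥ 4 /
characteristic `p`.  bears_on: LADDER-RESOLUTION:D157-DOOR2 (res-dim4-pi · F4-I bridge).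
Supports stmt-ResolutionOfSingularities-16155 (helper).
-/

set_option linter.dupNamespace false

noncomputable section

namespace Summit.ResolutionOfSingularities.ResolutionOfSingularities.Theorems.PIDim4

namespace WildConesBridge

open MvPolynomial Finset IsLocalRing
open Literature.AlgebraicGeometry.Resolution

variable {K : Type} [Field K]

/-! ## 1. `𝔪₀ K⟦x⟧ = 𝔪̂` and the formal Jacobian ideal -/

/-- The exponents of degree `1` on four variables are the four unit vectors. [folklore] -/
theorem setOf_degree_eq_one :
    {e : Fin 4 →₀ ℕ | e.degree = 1} = Set.range fun i : Fin 4 => Finsupp.single i 1 := by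
  ext e
  constructor
  · intro he
    obtain ⟨i, rfl⟩ := IsolationCert.exists_eq_single_of_degree_eq_one (γ := e) he
    exact ⟨i, rfl⟩
  · rintro ⟨i, rfl⟩
    exact Finsupp.degree_single i 1

/-- The maximal ideal of `K⟦x₁, …, x₄⟧` is generated by the variables. [folklore] -/
theorem maximalIdeal_eq_span_X :
    maximalIdeal (MvPowerSeries (Fin 4) K) =
      Ideal.span (Set.range fun i : Fin 4 => (MvPowerSeries.X i : MvPowerSeries (Fin 4) K)) := by
  have h := Literature.RingTheory.MvPowerSeries.Jets.maximalIdeal_pow_eq_span_monomial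
    (σ := Fin 4) (K := K) 1
  rw [pow_one, setOf_degree_eq_one, ← Set.range_comp] at h
  rw [h]
  rfl

/-- **`𝔪₀ · K⟦x⟧ = 𝔪̂`**: the origin ideal of `K[x₁..x₄]` generates the maximal ideal of `K⟦x₁..x₄⟧`.
[folklore] -/
theorem map_originIdeal_coe :
    (originIdeal K).map (MvPolynomial.coeToMvPowerSeries.ringHom : MvPolynomial (Fin 4) K →+* _) =
      maximalIdeal (MvPowerSeries (Fin 4) K) := by
  have hfun : (fun i : Fin 4 => (MvPowerSeries.X i : MvPowerSeries (Fin 4) K)) =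
      (MvPolynomial.coeToMvPowerSeries.ringHom : MvPolynomial (Fin 4) K →+* _) ∘
        fun i : Fin 4 => (X i : MvPolynomial (Fin 4) K) := by
    funext i
    rw [Function.comp_apply]
    exact (MvPolynomial.coe_X i).symm
  rw [IsolatedScope.originIdeal_eq_span_X, Ideal.map_span, maximalIdeal_eq_span_X, Finset.coe_univ,
    Set.image_univ, ← Set.range_comp, hfun]

/-- The maximal ideal of `K⟦x₁..x₄⟧` is finitely generated. [folklore] -/
theorem maximalIdeal_fg : (maximalIdeal (MvPowerSeries (Fin 4) K)).FG := by
  have h : (originIdeal K).FG := IsNoetherian.noetherian (originIdeal K)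
  have h2 := Ideal.FG.map h
    (MvPolynomial.coeToMvPowerSeries.ringHom : MvPolynomial (Fin 4) K →+* MvPowerSeries (Fin 4) K)
  rwa [map_originIdeal_coe] at h2

/-- **The formal Jacobian ideal is generated by the polynomial one**:
`⟨∂ᵢ ↑F⟩ = ⟨∂ᵢ F⟩ · K⟦x⟧`. [folklore] -/
theorem span_pderiv_coe (F : MvPolynomial (Fin 4) K) :
    Ideal.span (Set.range fun s : Fin 4 => MvPowerSeries.pderiv s (F : MvPowerSeries (Fin 4) K)) =
      (Ideal.span (Set.range fun s : Fin 4 => pderiv s F)).map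
        (MvPolynomial.coeToMvPowerSeries.ringHom : MvPolynomial (Fin 4) K →+* _) := by
  have hfun : (fun s : Fin 4 => MvPowerSeries.pderiv s (F : MvPowerSeries (Fin 4) K)) =
      (MvPolynomial.coeToMvPowerSeries.ringHom : MvPolynomial (Fin 4) K →+* _) ∘
        fun s : Fin 4 => pderiv s F := by
    funext s
    rw [Function.comp_apply, MvPowerSeries.pderiv_coe]
    rfl
  rw [Ideal.map_span, ← Set.range_comp, hfun]

/-- At `q = 2` the formal Jacobian ideal of `↑F` is `J₂⁺(F) · K⟦x⟧`. [folklore] -/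
theorem span_pderiv_coe_eq_map_singLocusIdeal (F : MvPolynomial (Fin 4) K) :
    Ideal.span (Set.range fun s : Fin 4 => MvPowerSeries.pderiv s (F : MvPowerSeries (Fin 4) K)) =
      (singLocusIdeal 2 F).map
        (MvPolynomial.coeToMvPowerSeries.ringHom : MvPolynomial (Fin 4) K →+* _) := by
  rw [span_pderiv_coe, IsolationCert.singLocusIdeal_two]

/-! ## 2. Isolated double point ⇒ finite formal Milnor algebra -/

/-- **A certificate in `K[x]` gives `𝔪̂ᴺ ≤ ⟨∂ᵢ ↑F⟩` in `K⟦x⟧`** (push forward, then Nakayama in the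
local ring `K⟦x⟧`). [folklore] -/
theorem maximalIdeal_pow_le_span_pderiv_of_certificate {F : MvPolynomial (Fin 4) K} {N : ℕ}
    (hN : originIdeal K ^ N ≤ singLocusIdeal 2 F ⊔ originIdeal K ^ (N + 1)) :
    maximalIdeal (MvPowerSeries (Fin 4) K) ^ N ≤
      Ideal.span (Set.range fun s : Fin 4 => MvPowerSeries.pderiv s (F : MvPowerSeries (Fin 4) K)) := by
  set φ : MvPolynomial (Fin 4) K →+* MvPowerSeries (Fin 4) K := MvPolynomial.coeToMvPowerSeries.ringHom
    with hφ
  have h := Ideal.map_mono (f := φ) hN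
  rw [Ideal.map_sup, Ideal.map_pow, Ideal.map_pow, hφ, map_originIdeal_coe,
    ← span_pderiv_coe_eq_map_singLocusIdeal] at h
  -- Nakayama: `𝔪̂ᴺ ≤ Ĵ ⊔ 𝔪̂ • 𝔪̂ᴺ` with `𝔪̂ ≤ jacobson ⊥`
  refine Submodule.le_of_le_smul_of_le_jacobson_bot (I := maximalIdeal (MvPowerSeries (Fin 4) K))
    (Ideal.FG.pow maximalIdeal_fg) (IsLocalRing.jacobson_eq_maximalIdeal ⊥ bot_ne_top).ge ?_
  rwa [Ideal.smul_eq_mul, ← pow_succ']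

/-- **An ISOLATED double point has a finite formal Milnor algebra**: `IsIsolated 2 F ⇒
dim_K K⟦x⟧ ⧸ ⟨∂₁↑F, …, ∂₄↑F⟩ < ∞` — the hypothesis `Isol` of the in-house route `WildCones`, from the
cell's frame.  (p-14's certificate `exists_certificate_of_isIsolated`, §1, Nakayama, jets.) [folklore] -/
theorem milnorFinite_of_isIsolated_two {F : MvPolynomial (Fin 4) K} (hiso : IsIsolated 2 F) :
    Module.Finite K (MvPowerSeries (Fin 4) K ⧸
      Ideal.span (Set.range fun s : Fin 4 => MvPowerSeries.pderiv s (F : MvPowerSeries (Fin 4) K))) := by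
  obtain ⟨N, hN⟩ := IsolationConverse.exists_certificate_of_isIsolated hiso
  have hle := maximalIdeal_pow_le_span_pderiv_of_certificate hN
  haveI := Literature.RingTheory.MvPowerSeries.Jets.finite_quotient_maximalIdeal_pow
    (σ := Fin 4) (K := K) N
  exact Module.Finite.of_surjective (Ideal.Quotient.factorₐ K hle).toLinearMap
    (Ideal.Quotient.factor_surjective hle)

end WildConesBridge

end Summit.ResolutionOfSingularities.ResolutionOfSingularities.Theorems.PIDim4

end
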